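import Summits.CriticalPhenomena.PercolationContinuityZ3.Theorems.PercNearOneGluingNoHeavyLowerTailSahiCombTriWShell

/-!
# `TRI_W(a)`: the shell / Kleitman / mixed-second-difference ("KQ") normal form, every index cube and every cube (no cylinder hypothesis)

Support file of the one-cut programme (crux `NoHeavyLowerTail`, stmt-CriticalPhenomena-4575; lemma factory `prim-lf-1` gen 29; memo
`FROM-prim-lf-1-gen29-RHO-INTERPOLATION.md` §5, remark).  Companion of `…SahiCombTriWShell` (Kleitman–shell form), `…SahiCombTriWPartialRefl` (partial-reflection form
on cells) and `…SahiCombTriWRectangle` (rectangle stratum).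

A third exact regrouping of `FiveUpSet.triW P F G`, valid for EVERY cube `W = Finset γ`, index cube `Finset β` and all `P, F, G`:

  `triW P F G = Σ_{e ∈ P} c(e) + Σ_x [#(P ∩ U_x) − #(refl P ∩ U_x)] + Σ_x Q_x`        (`triW_eq_kq`)

with `c = shellWeight F G` (`≥ 0` pointwise for monotone families), `U_x = F x ∩ G x` (so the middle sum is a sum of Kleitman gaps, `≥ 0` for up-sets), and the MIXED SECOND
DIFFERENCE `Q_x = #(P ∩ F x ∩ G xᶜ) − #(P ∩ refl (F x) ∩ G xᶜ) − #(P ∩ F x ∩ refl (G xᶜ)) + #(P ∩ refl (F x) ∩ refl (G xᶜ))`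
`= Σ_{e ∈ P} (1_{F x} − 1_{refl F x})(e) · (1_{G xᶜ} − 1_{refl G xᶜ})(e)` — the only unsigned piece (for `P = univ` it is `2·Kl(F x; G xᶜ) ≥ 0`; on a rectangle cell it factors
into a product of two Kleitman gaps, which is the mechanism of `…TriWRectangle`).  Hence the conditional stratum `triW_nonneg_of_mixedDiff_nonneg`: `Σ_x Q_x ≥ 0 ⟹ 0 ≤ triW`.
HONEST LABEL: an identity and an easy conditional stratum; `TriWIneq` remains OPEN — it is exactly the statement `−Σ_x Q_x ≤ Σ_P c + Σ_x Kl`. [this work]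
-/

namespace Summit.CriticalPhenomena.PercolationContinuityZ3.Theorems

namespace FiveUpSet

open Finset

variable {β γ : Type} [DecidableEq β] [Fintype β] [DecidableEq γ] [Fintype γ]

/-- The mixed second difference of `P` against the pair `(F x, G xᶜ)` under the antipode:
`Q_x = #(P ∩ F x ∩ G xᶜ) − #(P ∩ refl (F x) ∩ G xᶜ) − #(P ∩ F x ∩ refl (G xᶜ)) + #(P ∩ refl (F x) ∩ refl (G xᶜ))`, written out (no new definition). [this work] -/
theorem triWTerm_eq_kq (P : Finset (Finset γ)) (F G : Finset β → Finset (Finset γ)) (x : Finset β) :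
    triWTerm P F G x
      = (((P ∩ F x ∩ G x).card : ℤ) - (P ∩ F x ∩ G xᶜ).card)
        + (((P ∩ F x ∩ G x).card : ℤ) - (refl P ∩ F x ∩ G x).card)
        + ((((P ∩ F x ∩ G xᶜ).card : ℤ) - (P ∩ refl (F x) ∩ G xᶜ).card) - (P ∩ F x ∩ refl (G xᶜ)).card
            + (P ∩ refl (F x) ∩ refl (G xᶜ)).card) := by
  unfold triWTerm
  rw [card_refl_inter_inter]
  ring

/-- **KQ normal form of `TRI_W(a)`** (every index cube, every cube, no hypothesis on `P, F, G`):
`triW P F G = Σ_{e∈P} shellWeight F G e + Σ_x [#(P ∩ F x ∩ G x) − #(refl P ∩ F x ∩ G x)] + Σ_x Q_x`. [this work] -/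
theorem triW_eq_kq (P : Finset (Finset γ)) (F G : Finset β → Finset (Finset γ)) :
    triW P F G = ∑ e ∈ P, shellWeight F G e
      + ∑ x : Finset β, (((P ∩ F x ∩ G x).card : ℤ) - (refl P ∩ F x ∩ G x).card)
      + ∑ x : Finset β, ((((P ∩ F x ∩ G xᶜ).card : ℤ) - (P ∩ refl (F x) ∩ G xᶜ).card) - (P ∩ F x ∩ refl (G xᶜ)).card
            + (P ∩ refl (F x) ∩ refl (G xᶜ)).card) := by
  unfold triW
  rw [sum_shellWeight_eq, ← sum_add_distrib, ← sum_add_distrib]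
  exact sum_congr rfl fun x _ => triWTerm_eq_kq P F G x

omit [DecidableEq β] in
/-- The Kleitman part of the KQ form is non-negative for up-sets: `Σ_x #(refl P ∩ U_x) ≤ Σ_x #(P ∩ U_x)`, `U_x = F x ∩ G x`. [this work] -/
theorem sum_card_refl_inter_le (P : Finset (Finset γ)) (F G : Finset β → Finset (Finset γ))
    (hP : IsUpperSet (P : Set (Finset γ))) (hF : ∀ x, IsUpperSet (F x : Set (Finset γ))) (hG : ∀ x, IsUpperSet (G x : Set (Finset γ))) :
    0 ≤ ∑ x : Finset β, (((P ∩ F x ∩ G x).card : ℤ) - (refl P ∩ F x ∩ G x).card) := by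
  refine sum_nonneg fun x _ => sub_nonneg.2 ?_
  have hU : IsUpperSet ((F x ∩ G x : Finset (Finset γ)) : Set (Finset γ)) := by
    rw [coe_inter]; exact (hF x).inter (hG x)
  have h := card_refl_inter_le hU hP
  rw [inter_assoc, inter_assoc]
  exact_mod_cast h

/-- **The mixed-difference-positive stratum (conditional).**  If the mixed second differences sum to a non-negative number,
`0 ≤ Σ_x Q_x`, then `0 ≤ triW P F G` for up-sets `P, F x, G x` and monotone `F, G` — since the shell weights and the Kleitman part are `≥ 0`.
(Examples: `P = univ`, where `Q_x = 2·Kl(F x; G xᶜ)`; rectangles on cells, `…TriWRectangle`.) [this work] -/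
theorem triW_nonneg_of_mixedDiff_nonneg (P : Finset (Finset γ)) (F G : Finset β → Finset (Finset γ))
    (hP : IsUpperSet (P : Set (Finset γ))) (hF : ∀ x, IsUpperSet (F x : Set (Finset γ))) (hG : ∀ x, IsUpperSet (G x : Set (Finset γ)))
    (hFm : Monotone F) (hGm : Monotone G)
    (hQ : 0 ≤ ∑ x : Finset β, ((((P ∩ F x ∩ G xᶜ).card : ℤ) - (P ∩ refl (F x) ∩ G xᶜ).card) - (P ∩ F x ∩ refl (G xᶜ)).card
            + (P ∩ refl (F x) ∩ refl (G xᶜ)).card)) :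
    0 ≤ triW P F G := by
  rw [triW_eq_kq]
  have h1 : 0 ≤ ∑ e ∈ P, shellWeight F G e := sum_nonneg fun e _ => shellWeight_nonneg hFm hGm e
  have h2 := sum_card_refl_inter_le P F G hP hF hG
  linarith

end FiveUpSet

end Summit.CriticalPhenomena.PercolationContinuityZ3.Theorems
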